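import Literature.AlgebraicGeometry.Frobenioids.PadicKummerIsoTransport
import HarnessLib

/-!
# Frobenioids II, Theorem 2.4 (i)(ii), Remark 2.4.1: discharge of the typed statements along an
# isomorphism of the Definition 2.2 contexts

Mochizuki, *The geometry of Frobenioids II*, Kyushu J. Math. **62** (2008) 401–460, §2, Theorem 2.4
pp. 19–22 [cite: MochizukiFrdII2008, Thm 2.4 (i) p.19]. PROOF-ONLY companion (seat abc-iut-L1-d4,
gen 2) to abc-iut-L1-t7's `PadicKummerSetting.lean` / `PadicKummerActions.lean` /
`PadicKummerContextIso.lean`, over the constructions of `PadicKummerIsoTransport.lean`.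

**What is discharged, and modulo what (schema-label rule).** The typed Theorem 2.4 statements
`Thm24i`, `Thm24iExistsData`, `Thm24ii`, `Thm24iActionCompat`, `Rmk241Indeterminacy` are schemas over
two contexts `X₁ X₂ : Def22Context` and free comparison data `T : Thm24Data X₁ X₂ N`; the printed
theorem is their instantiation at the contexts of `(N, Hᵢ)`-saturated objects `A₁`, `A₂ = Ψ(A₁)` of
two `pᵢ`-adic Frobenioids and at the data INDUCED BY `Ψ`. Here the binding is: any two contexts
related by an isomorphism `e : X₁.Iso X₂` of the Definition 2.2 data (= what `Ψ`, `Ψ_Base` and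
"`Ψ` preserves `O^⊳(−)`" induce — the category-theoretic inputs [FrdI] Thm. 3.4 (v), Cor. 4.10,
4.11 (ii)(iii), [SemiAnbd] Prop. 3.2, [AbsAnab] Thm. 1.1.1 (ii) of the printed proof, p. 19–20),
and `T := e.thm24Data N`, the data CONSTRUCTED from `e`. Over this binding we PROVE outright:
"`Ψ` maps `(N, H₁)`-saturated objects to `(N, H₂)`-saturated objects", the five induced
isomorphisms, the compatibility with the Kummer maps, the compatibility with "the various natural
actions of `(Gᵢ)_{Aᵢ}/(Hᵢ)_{Aᵢ}`" (`thm24iActionCompat`), and Remark 2.4.1's finite-level content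
(`rmk241Indeterminacy`, with trivial indeterminacy for data induced by the same `Ψ`). The remaining
printed inputs enter as NAMED HYPOTHESES, never as axioms: `p₁ = p₂` ("follows from the existence of
the isomorphism `G₁ ⥲ G₂` [AbsAnab, Prop. 1.2.1 (i)]", p. 20), "`Φ₁` is fieldwise saturated iff
`Φ₂` is" ([FrdI] Cor. 4.10, 4.11, p. 20), and the functoriality of the local-duality isomorphism
`H¹(H_A, μ_N(A)) ⥲ H_A^ab ⊗ F_N(A)` "induced by the cup product" (p. 18; local class field theory,
[NSW] Thm. 7.2.6 — FOUNDATIONS row 15, abc-iut-L4-t4's `mlf_H1_mu_equiv_abelianization_mod` pin;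
the duality isomorphisms are DATA `Kummer.DualityIso` in the typed statements, so their naturality
is necessarily an input here) — `thm24i_of_inputs`, `thm24iExistsData_of_inputs`; and Theorem 2.4
(ii) is, as printed, entirely the Brauer-group argument of pp. 20–22 about the LCFT invariant maps
`F_N(Aᵢ) ⥲ ℤ/Nℤ` (DATA `FNInvariant`), recorded as `thm24ii_of_invariant_compat`. The identity case
`Ψ = 𝟭` (`Iso.refl`) is a kernel witness that the schemas are satisfiable on EVERY context
(`thm24i_refl`). Nothing here concerns [IUTchIII]; no statement of abc-iut-L1-t7 is restated.
-/

namespace Literature.AlgebraicGeometry.Frobenioids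

namespace PadicKummer

open CategoryTheory groupCohomology Kummer

namespace Def22Context.Iso

variable {X₁ X₂ : Def22Context} (e : Def22Context.Iso X₁ X₂)

/-! ### Theorem 2.4 (i) -/

/-- **Theorem 2.4 (i)** (FrdII pp. 19–20) for the comparison data `e.thm24Data N` induced by an
isomorphism of the Definition 2.2 contexts, from the three residual printed inputs as hypotheses:
`p₁ = p₂` ([AbsAnab] Prop. 1.2.1 (i)), "`Φ₁` fieldwise saturated iff `Φ₂`" ([FrdI] Cor. 4.10/4.11),
and the naturality of the local-duality isomorphisms `ιᵢ` (cup product, [NSW] 7.2.6) with respect to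
the induced maps. The saturation transfer, the five isomorphisms and the Kummer compatibility are
PROVED (`PadicKummerIsoTransport.lean`). [cite: MochizukiFrdII2008, Thm 2.4 (i) p.19] -/
theorem thm24i_of_inputs (N : ℕ) (p₁ p₂ : ℕ) (fs₁ fs₂ : Prop)
    (ι₁ : DualityIso N X₁.O X₁.HA X₁.qHA) (ι₂ : DualityIso N X₂.O X₂.HA X₂.qHA)
    (hp : p₁ = p₂) (hfs : fs₁ ↔ fs₂)
    (hι : ∀ c, (e.thm24Data N).recTargetMap (ι₁.toAddEquiv c) = ι₂.toAddEquiv (e.isoH1 N c)) :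
    Thm24i X₁ X₂ N p₁ p₂ fs₁ fs₂ (e.thm24Data N) ι₁ ι₂ :=
  ⟨hfs, hp, (e.isNHSaturated_iff N).mp,
    fun hO₁ hO₂ f₁ f₂ hf => e.isoH1_kummerClass N hO₁ hO₂ f₁ f₂ hf, hι⟩

/-- **Theorem 2.4 (i), existence form for every `N`** (`Thm24iExistsData`), from the same three
inputs (the duality naturality now for every `N ≥ 1`); the data are `e.thm24Data N`.
[cite: MochizukiFrdII2008, Thm 2.4 (i) p.19] -/
theorem thm24iExistsData_of_inputs (p₁ p₂ : ℕ) (fs₁ fs₂ : Prop)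
    (ι₁ : ∀ N, DualityIso N X₁.O X₁.HA X₁.qHA) (ι₂ : ∀ N, DualityIso N X₂.O X₂.HA X₂.qHA)
    (hp : p₁ = p₂) (hfs : fs₁ ↔ fs₂)
    (hι : ∀ N, 0 < N → ∀ c,
      (e.thm24Data N).recTargetMap ((ι₁ N).toAddEquiv c) = (ι₂ N).toAddEquiv (e.isoH1 N c)) :
    Thm24iExistsData X₁ X₂ p₁ p₂ fs₁ fs₂ ι₁ ι₂ :=
  fun N hN => ⟨e.thm24Data N, e.thm24i_of_inputs N p₁ p₂ fs₁ fs₂ (ι₁ N) (ι₂ N) hp hfs (hι N hN)⟩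

/-! ### Theorem 2.4 (ii) -/

/-- **Theorem 2.4 (ii)** (FrdII p. 20) for the data `e.thm24Data N`: "the isomorphism
`F_N(A₁) ⥲ F_N(A₂)` of (i) is compatible with the natural isomorphisms `F_N(Aᵢ) ⥲ ℤ/Nℤ`". In the
typed statement the invariant maps are DATA (`FNInvariant`, the LCFT boundary), and the printed proof
(pp. 20–22) is entirely the Brauer-group computation `H²(Gᵢ, μ(K̄ᵢ^×)) ⥲ ℚ/ℤ` + [AbsAnab] Prop. 1.2.1
(ii)(iv)(vii); accordingly the content enters as the hypothesis `hinv` (compatibility of the chosen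
invariant maps with `e.isoFN N`) and nothing generic remains to prove — recorded for completeness of
the node, HONESTLY CONDITIONAL. [cite: MochizukiFrdII2008, Thm 2.4 (ii) p.20] -/
theorem thm24ii_of_invariant_compat (N : ℕ) (fs₁ fs₂ : Prop) (inv₁ : FNInvariant X₁ N)
    (inv₂ : FNInvariant X₂ N)
    (hinv : ∀ x : FN X₁ N, inv₂.toAddEquiv (e.isoFN N x) = inv₁.toAddEquiv x) :
    Thm24ii X₁ X₂ N fs₁ fs₂ (e.thm24Data N) inv₁ inv₂ :=
  fun _ _ x => hinv x

/-! ### Remark 2.4.1 (finite level) -/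

/-- **Remark 2.4.1**, finite-level content (FrdII p. 22), for data induced by the SAME `Ψ` at two
levels `N`, `N'`: they agree on `O^□` and on `(H₁)_{A₁}` exactly, i.e. up to the (trivial) element
`1 ∈ G₂` — the typed `(G₂)_{A₂}/(H₂)_{A₂}`-indeterminacy predicate holds.
[cite: MochizukiFrdII2008, Rmk 2.4.1 p.22] -/
theorem rmk241Indeterminacy (N N' : ℕ) :
    Rmk241Indeterminacy X₁ X₂ (e.thm24Data N) (e.thm24Data N') :=
  ⟨1, fun x => by
      show e.isoO x = X₂.outer 1 • e.isoO x
      rw [map_one, one_smul],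
    fun k => by
      show ((e.isoHA k : X₂.HA) : X₂.AutE) = X₂.outer 1 * ((e.isoHA k : X₂.HA) : X₂.AutE) * (X₂.outer 1)⁻¹
      rw [map_one, one_mul, inv_one, mul_one]⟩

/-! ### Theorem 2.4 (i), the clause on the natural actions of `(Gᵢ)_{Aᵢ}/(Hᵢ)_{Aᵢ}` -/

/-- `isoHA⁻¹` intertwines conjugation by `outer₂ (isoG g)` on `(H₂)_{A₂}` with conjugation by
`outer₁ g` on `(H₁)_{A₁}`. [cite: MochizukiFrdII2008, Thm 2.4 (i) p.20] -/
theorem isoHA_symm_conj (g : X₁.G) (k : X₂.HA) :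
    e.isoHA.symm ⟨X₂.outer (e.isoG g) * k * (X₂.outer (e.isoG g))⁻¹,
        X₂.outer_conj_mem_HA (e.isoG g) k k.2⟩ =
      ⟨X₁.outer g * (e.isoHA.symm k : X₁.AutE) * (X₁.outer g)⁻¹,
        X₁.outer_conj_mem_HA g _ (e.isoHA.symm k).2⟩ := by
  apply Subtype.ext
  show ((e.isoHA.symm ⟨X₂.outer (e.isoG g) * k * (X₂.outer (e.isoG g))⁻¹,
      X₂.outer_conj_mem_HA (e.isoG g) k k.2⟩ : X₁.HA) : X₁.AutE) =
    X₁.outer g * (e.isoHA.symm k : X₁.AutE) * (X₁.outer g)⁻¹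
  rw [coe_isoHA_symm, coe_isoHA_symm]
  change e.isoE.symm (X₂.outer (e.isoG g) * k * (X₂.outer (e.isoG g))⁻¹) = _
  rw [e.outer_isoG, map_mul, map_mul, map_inv, MulEquiv.symm_apply_apply]

/-- **Theorem 2.4 (i), final clause** (FrdII p. 20): the induced isomorphisms are "compatible …
with the various natural actions of `(G₁)_{A₁}/(H₁)_{A₁}`, `(G₂)_{A₂}/(H₂)_{A₂}`" — abc-iut-L1-t7's
`Thm24iActionCompat`, PROVED for the data `e.thm24Data N`: equivariance of `isoO` and `isoHA`, and
naturality of `isoH1` (resp. `isoFN`) with respect to the actions `h1ActG` (resp. `fnActG`), by the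
cocycle formula for `isoH1` (resp. functoriality of continuous cohomology).
[cite: MochizukiFrdII2008, Thm 2.4 (i) p.20] -/
theorem thm24iActionCompat (N : ℕ) : Thm24iActionCompat X₁ X₂ N (e.thm24Data N) := by
  intro g
  refine ⟨fun x => ?_, fun k => ?_, fun c => ?_, fun x => ?_⟩
  · -- `O^□`: `isoO (outer₁ g • x) = outer₂ (isoG g) • isoO x`
    show e.isoO (X₁.outer g • x) = X₂.outer (e.isoG g) • e.isoO x
    rw [e.isoO_smul, e.outer_isoG]
  · -- `H_A`: `isoHA` intertwines the conjugations
    show ((e.isoHA ⟨X₁.outer g * k * (X₁.outer g)⁻¹, X₁.outer_conj_mem_HA g k k.2⟩ : X₂.HA) :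
        X₂.AutE) = X₂.outer (e.isoG g) * ((e.isoHA k : X₂.HA) : X₂.AutE) * (X₂.outer (e.isoG g))⁻¹
    rw [coe_isoHA, coe_isoHA, e.outer_isoG]
    change e.isoE (X₁.outer g * k * (X₁.outer g)⁻¹) = _
    rw [map_mul, map_mul, map_inv]
  · -- `H¹`: naturality of `isoH1` w.r.t. `h1ActG`
    show e.isoH1 N ((X₁.h1ActG N g).hom c) = (X₂.h1ActG N (e.isoG g)).hom (e.isoH1 N c)
    induction c using H1_induction_on with
    | h x =>
      have h₁ : (X₁.h1ActG N g).hom (H1π _ x) =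
          H1π _ (mapCocycles₁ (conjSubgroupHom (X₁.outer g) X₁.HA X₁.HA (X₁.outer_conj_mem_HA g) :
            X₁.HA →* X₁.HA) _ x) :=
        H1π_comp_map_apply _ _ x
      have h₂ : (X₂.h1ActG N (e.isoG g)).hom
            (H1π _ (mapCocycles₁ (e.isoHA.symm : X₂.HA →* X₁.HA) (e.muRepHom N) x)) =
          H1π _ (mapCocycles₁ (conjSubgroupHom (X₂.outer (e.isoG g)) X₂.HA X₂.HA
            (X₂.outer_conj_mem_HA (e.isoG g)) : X₂.HA →* X₂.HA) _
            (mapCocycles₁ (e.isoHA.symm : X₂.HA →* X₁.HA) (e.muRepHom N) x)) :=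
        H1π_comp_map_apply _ _ _
      rw [h₁, isoH1_H1π, isoH1_H1π, h₂]
      refine congrArg _ (cocycles₁_ext fun k => ?_)
      change Additive.ofMul (e.muIso N (Additive.toMul (Additive.ofMul ((X₁.outer g)⁻¹ •
          Additive.toMul (show Additive (Mu N X₁.O) from
            x ⟨X₁.outer g * (e.isoHA.symm k : X₁.AutE) * (X₁.outer g)⁻¹,
              X₁.outer_conj_mem_HA g _ (e.isoHA.symm k).2⟩))))) =
        Additive.ofMul ((X₂.outer (e.isoG g))⁻¹ • Additive.toMul (Additive.ofMul (e.muIso N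
          (Additive.toMul (show Additive (Mu N X₁.O) from
            x (e.isoHA.symm ⟨X₂.outer (e.isoG g) * k * (X₂.outer (e.isoG g))⁻¹,
              X₂.outer_conj_mem_HA (e.isoG g) k k.2⟩))))))
      rw [toMul_ofMul, toMul_ofMul, isoHA_symm_conj, muIso_smul, e.outer_isoG, map_inv]
  · -- `F_N`: naturality of `isoFN` w.r.t. `fnActG`
    show e.isoFN N (X₁.fnActG N g x) = X₂.fnActG N (e.isoG g) (e.isoFN N x)
    induction x using QuotientAddGroup.induction_on with
    | H y =>
      have key : cohAct N X₁.O X₁.HA (X₁.outer g) (X₁.outer_conj_mem_HA g) 2 ≫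
            (e.transportMu N).push 2 =
          (e.transportMu N).push 2 ≫
            cohAct N X₂.O X₂.HA (X₂.outer (e.isoG g)) (X₂.outer_conj_mem_HA (e.isoG g)) 2 := by
        rw [cohAct, cohAct, InflTransport₂.push, ← ContinuousCohomology.map_comp,
          ← ContinuousCohomology.map_comp]
        refine contMap_congr ?_ _ _ (fun z => ?_) 2
        · refine ContinuousMonoidHom.ext fun k => ?_
          show (⟨X₁.outer g * (e.isoHA.symm k : X₁.AutE) * (X₁.outer g)⁻¹,
              X₁.outer_conj_mem_HA g _ (e.isoHA.symm k).2⟩ : X₁.HA) =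
            e.isoHA.symm ⟨X₂.outer (e.isoG g) * k * (X₂.outer (e.isoG g))⁻¹,
              X₂.outer_conj_mem_HA (e.isoG g) k k.2⟩
          rw [isoHA_symm_conj]
        · show Additive.ofMul (e.muIso N (Additive.toMul (Additive.ofMul ((X₁.outer g)⁻¹ •
              Additive.toMul (show Additive (Mu N X₁.O) from z))))) =
            Additive.ofMul ((X₂.outer (e.isoG g))⁻¹ • Additive.toMul (Additive.ofMul (e.muIso N
              (Additive.toMul (show Additive (Mu N X₁.O) from z)))))
          rw [toMul_ofMul, toMul_ofMul, muIso_smul, e.outer_isoG, map_inv]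
      have key' := congr_arg (fun φ => φ.hom y) key
      simp only [TopModuleCat.hom_comp, ContinuousLinearMap.coe_comp, Function.comp_apply] at key'
      have h₁ : X₁.fnActG N g (y : FN X₁ N) =
          (((cohAct N X₁.O X₁.HA (X₁.outer g) (X₁.outer_conj_mem_HA g) 2).hom y :
            continuousCohomology 2 (muTopRep N X₁.O X₁.HA)) : FN X₁ N) := rfl
      have h₂ : ∀ z : continuousCohomology 2 (muTopRep N X₂.O X₂.HA),
          X₂.fnActG N (e.isoG g) (z : FN X₂ N) =
            (((cohAct N X₂.O X₂.HA (X₂.outer (e.isoG g)) (X₂.outer_conj_mem_HA (e.isoG g)) 2).hom z :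
              continuousCohomology 2 (muTopRep N X₂.O X₂.HA)) : FN X₂ N) := fun z => rfl
      rw [h₁, isoFN_mk, isoFN_mk, h₂, key']


/-! ### Transport of the remaining Definition 2.2 / Remark 2.2.1 named facts along the isomorphism -/

include e in
/-- `μ_N`-saturation (Def. 2.1 (i)) transports along a context isomorphism.
[cite: MochizukiFrdII2008, Def 2.1 (i) p.16] -/
theorem isMuSaturated_iff (N : ℕ) : IsMuSaturated N X₁.O ↔ IsMuSaturated N X₂.O :=
  ⟨fun ⟨⟨a⟩⟩ => ⟨⟨(e.muIso N).symm.trans a⟩⟩, fun ⟨⟨a⟩⟩ => ⟨⟨(e.muIso N).trans a⟩⟩⟩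

include e in
/-- The torsor property of `N`-th roots ([FrdI] Def. 1.3 (vi), `Kummer.NthRootsDifferByUnits`)
transports along a context isomorphism. [cite: MochizukiFrdII2008, Def 2.1 (ii) p.16] -/
theorem nthRootsDifferByUnits_iff (N : ℕ) :
    NthRootsDifferByUnits N X₁.O ↔ NthRootsDifferByUnits N X₂.O := by
  constructor
  · rintro ⟨h⟩
    refine ⟨fun g g' hg => ?_⟩
    obtain ⟨u, hu⟩ := h (e.isoO.symm g) (e.isoO.symm g') (by rw [← map_pow, ← map_pow, hg])
    refine ⟨Units.map e.isoO.toMonoidHom u, ?_⟩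
    apply e.isoO.symm.injective
    rw [hu, map_mul, Units.coe_map, MulEquiv.coe_toMonoidHom, MulEquiv.symm_apply_apply]
  · rintro ⟨h⟩
    refine ⟨fun g g' hg => ?_⟩
    obtain ⟨u, hu⟩ := h (e.isoO g) (e.isoO g') (by rw [← map_pow, ← map_pow, hg])
    refine ⟨Units.map e.isoO.symm.toMonoidHom u, ?_⟩
    apply e.isoO.injective
    rw [hu, map_mul, Units.coe_map, MulEquiv.coe_toMonoidHom, MulEquiv.apply_symm_apply]

include e in
/-- "Any element `f ∈ O^□(A)^H` admits an `N`-th root" (Rmk. 2.2.1, `Kummer.InvariantsAdmitRoots`)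
transports along a context isomorphism. [cite: MochizukiFrdII2008, Rmk 2.2.1 p.18] -/
theorem invariantsAdmitRoots_iff (N : ℕ) :
    InvariantsAdmitRoots N X₁.O X₁.HA ↔ InvariantsAdmitRoots N X₂.O X₂.HA := by
  constructor
  · intro h f₂ hf₂
    obtain ⟨g₁, hg₁⟩ := h (e.isoO.symm f₂) fun k => by
      apply e.isoO.injective
      rw [e.isoO_smul_HA, MulEquiv.apply_symm_apply]
      exact hf₂ (e.isoHA k)
    exact ⟨e.isoO g₁, by rw [← map_pow, hg₁, MulEquiv.apply_symm_apply]⟩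
  · intro h f₁ hf₁
    obtain ⟨g₂, hg₂⟩ := h (e.isoO f₁) fun k => by
      obtain ⟨k₁, rfl⟩ := e.isoHA.surjective k
      rw [← e.isoO_smul_HA, hf₁ k₁]
    exact ⟨e.isoO.symm g₂, by rw [← map_pow, hg₂, MulEquiv.symm_apply_apply]⟩

include e in
/-- Remark 2.2.1's `SaturatedInvariantsAdmitRoots` transports along a context isomorphism.
[cite: MochizukiFrdII2008, Rmk 2.2.1 p.18] -/
theorem saturatedInvariantsAdmitRoots_iff (N : ℕ) :
    SaturatedInvariantsAdmitRoots X₁ N ↔ SaturatedInvariantsAdmitRoots X₂ N := by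
  unfold SaturatedInvariantsAdmitRoots
  rw [e.isNHSaturated_iff N, e.invariantsAdmitRoots_iff N]

include e in
/-- Definition 2.2 (i)'s `GaloisSurjective` ("`G_A ↪ Aut_E(A_E)` is an isomorphism if `A_D` is
Galois") transports along a context isomorphism (via `isoGA`, `gaToAutE_isoGA`).
[cite: MochizukiFrdII2008, Def 2.2 (i) p.17] -/
theorem galoisSurjective_iff : X₁.GaloisSurjective ↔ X₂.GaloisSurjective := by
  have key : ⇑X₂.gaToAutE ∘ ⇑e.isoGA = ⇑e.isoE ∘ ⇑X₁.gaToAutE := funext fun a => e.gaToAutE_isoGA a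
  unfold GaloisSurjective
  rw [← e.isGalois_iff]
  refine imp_congr_right fun _ => ?_
  constructor
  · intro h
    have h' : Function.Surjective (⇑X₂.gaToAutE ∘ ⇑e.isoGA) := by
      rw [key]; exact e.isoE.surjective.comp h
    exact Function.Surjective.of_comp h'
  · intro h
    have h' : Function.Surjective (⇑e.isoE ∘ ⇑X₁.gaToAutE) := by
      rw [← key]; exact h.comp e.isoGA.surjective
    exact (Function.Surjective.of_comp_iff' e.isoE.bijective _).mp h'

/-! ### The identity case `Ψ = 𝟭`: the schemas are satisfiable on every context -/

section Refl

variable (X : Def22Context) (N : ℕ)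

/-- For `Ψ = 𝟭`, `μ_N ⥲ μ_N` is the identity. [cite: MochizukiFrdII2008, Thm 2.4 (i) p.19] -/
@[simp] theorem muIso_refl (ζ : Mu N X.O) : (Iso.refl X).muIso N ζ = ζ :=
  Mu.ext (Units.ext rfl)

/-- For `Ψ = 𝟭`, `isoHA` is the identity. [cite: MochizukiFrdII2008, Thm 2.4 (i) p.19] -/
@[simp] theorem isoHA_refl (k : X.HA) : (Iso.refl X).isoHA k = k := Subtype.ext rfl

/-- For `Ψ = 𝟭`, `isoHA⁻¹` is the identity. [cite: MochizukiFrdII2008, Thm 2.4 (i) p.19] -/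
@[simp] theorem isoHA_refl_symm (k : X.HA) : (Iso.refl X).isoHA.symm k = k := by
  apply (Iso.refl X).isoHA.injective
  rw [MulEquiv.apply_symm_apply, isoHA_refl]

/-- For `Ψ = 𝟭`, `isoH1` is the identity. [cite: MochizukiFrdII2008, Thm 2.4 (i) p.19] -/
@[simp] theorem isoH1_refl (c : H1 (Rep.ofMulDistribMulAction X.HA (Mu N X.O))) :
    (Iso.refl X).isoH1 N c = c := by
  induction c using H1_induction_on with
  | h x =>
    rw [isoH1_H1π]
    refine congrArg _ (cocycles₁_ext fun k => ?_)
    change Additive.ofMul ((Iso.refl X).muIso N (Additive.toMul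
        (show Additive (Mu N X.O) from x ((Iso.refl X).isoHA.symm k)))) = x k
    rw [muIso_refl, isoHA_refl_symm, ofMul_toMul]

/-- For `Ψ = 𝟭`, `isoFN` is the identity. [cite: MochizukiFrdII2008, Thm 2.4 (i) p.19] -/
@[simp] theorem isoFN_refl (x : FN X N) : (Iso.refl X).isoFN N x = x := by
  induction x using QuotientAddGroup.induction_on with
  | H y =>
    rw [isoFN_mk]
    congr 1
    have : ((Iso.refl X).transportMu N).push 2 = 𝟙 _ := by
      rw [InflTransport₂.push]
      exact contMap_eq_id _ _ (ContinuousMonoidHom.ext fun k => isoHA_refl_symm X k)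
        (fun z => by
          show Additive.ofMul ((Iso.refl X).muIso N (Additive.toMul z)) = z
          rw [muIso_refl, ofMul_toMul]) 2
    rw [this]
    rfl

/-- For `Ψ = 𝟭`, the map `H_A^ab ⊗ F_N → H_A^ab ⊗ F_N` induced by the comparison data is the
identity. [cite: MochizukiFrdII2008, Thm 2.4 (i) p.19] -/
theorem recTargetMap_refl (t : RecTarget N X.O X.HA X.qHA) :
    ((Iso.refl X).thm24Data N).recTargetMap t = t := by
  have h1 : (MonoidHom.toAdditive
      (Abelianization.map ((Iso.refl X).thm24Data N).isoHA.toMonoidHom)).toIntLinearMap =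
        LinearMap.id := by
    apply LinearMap.ext
    intro a
    have hid : ((Iso.refl X).thm24Data N).isoHA.toMonoidHom = MonoidHom.id _ :=
      MonoidHom.ext fun k => isoHA_refl X k
    rw [hid, Abelianization.map_id]
    rfl
  have h2 : ((Iso.refl X).thm24Data N).isoFN.toAddMonoidHom.toIntLinearMap = LinearMap.id := by
    apply LinearMap.ext
    intro x
    exact isoFN_refl X N x
  rw [Thm24Data.recTargetMap, h1, h2, TensorProduct.map_id]
  rfl

/-- **Theorem 2.4 for `Ψ = 𝟭`** (kernel witness that the typed schemas `Thm24Data`/`Thm24i` are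
satisfiable on EVERY context, with the identity data): all clauses hold with `p₁ = p₂`, `fs₁ = fs₂`
and `ι₁ = ι₂`. [cite: MochizukiFrdII2008, Thm 2.4 (i) p.19] -/
theorem thm24i_refl (p : ℕ) (fs : Prop) (ι : DualityIso N X.O X.HA X.qHA) :
    Thm24i X X N p p fs fs ((Iso.refl X).thm24Data N) ι ι :=
  (Iso.refl X).thm24i_of_inputs N p p fs fs ι ι rfl Iff.rfl fun c => by
    rw [recTargetMap_refl, isoH1_refl]

/-- **Theorem 2.4 (ii) for `Ψ = 𝟭`**: the identity is compatible with any invariant map.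
[cite: MochizukiFrdII2008, Thm 2.4 (ii) p.20] -/
theorem thm24ii_refl (fs : Prop) (inv : FNInvariant X N) :
    Thm24ii X X N fs fs ((Iso.refl X).thm24Data N) inv inv :=
  (Iso.refl X).thm24ii_of_invariant_compat N fs fs inv inv fun x => by
    show inv.toAddEquiv ((Iso.refl X).isoFN N x) = inv.toAddEquiv x
    rw [isoFN_refl]

end Refl

end Def22Context.Iso

end PadicKummer

end Literature.AlgebraicGeometry.Frobenioids
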